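import Mathlib
import Summits.NavierStokesRegularity.NavierStokesRegularity.Theorems.TaoLadderRungTwoFlatCertificateGlueLohnerStepOn
import HarnessLib

/-!
# Certificate glue on a shift set `𝕊`, XVIII-c: THE MEAN-VALUE LOHNER NODE STEP WITH A REMAINDER VECTOR and the
  PRODUCT-FORM flow tube (helper for items stmt-NavierStokesRegularity-22987 `FlatGapCertificatesV2` (crux K_A♭ of
  route TaoLadderRungTwoFlat) and stmt-24295 K_A₂(64); cell harvest/h2-tao-ladder, p1 g16; theory-1 asks A-73 / A-75
  (NUM-T41m F-19/F-20 «a remainder VECTOR is necessary and sufficient for B_*′; lohner2 = mean-value node»,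
  NUM-T41o F-30 / A75-NOTE «product-form box cover»))

Abstract finite-dimensional ODE analysis for a bilinear field `Q` on `Fin n → ℝ`, complementing glue XVIII/XVIII-b
(`lohner_land`, `lohner_land_approx`: SCALAR remainder `E₀ → E₁`, second-order deviation clause `Dev`):

* `hasDerivAt_taylorJet_line`, `hasDerivAt_TPoly_line`: along a line `θ ↦ x + θ v` the Taylor jets / the Taylor
  polynomial `TP_u` of the flow have derivative the variational jets / the variational polynomial `VPoly … v u` AT THE
  MOVING BASE POINT (the variational recursion is the linearisation of the Taylor recursion);
* `exists_TPoly_sub_eq_VPoly`: the MEAN-VALUE FORM `TP_u(x+v)_c − TP_u(x)_c = VPoly(x + θ_c v) v u _c`, `θ_c ∈ [0,1]`;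
* `lohner_land_mv`: THE MEAN-VALUE LOHNER LANDING WITH A REMAINDER VECTOR — every solution on `[0,h]` from the node
  `{x + C ξ + e : |ξ| ≤ r, |e_c| ≤ E_c}` (per-component `E`, per-row frame radii `ρ_c ≥ |(Cξ)_c|`) ends in
  `{x' + C' ξ' + e' : |ξ'| ≤ r', |e'_c| ≤ E'_c}` with `ξ' := T ξ`, provided: the centre defect `|TP_h(x) − x'|_c ≤ dP_c`,
  the FRAME ENCLOSURE `|VPoly(z)(Cξ)_c − (C' T ξ)_c| ≤ κ_c` for every `z` in the node hull box and `ξ` in its box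
  (interval variational columns over the hull box against the point matrix `C' T`), the REMAINDER-DIRECTION bound
  `|VPoly(z)(e)_c| ≤ NVE_c`, the transport `|T ξ| ≤ r'`, and the per-component E-RECURSION
  `dP_c + κ_c + NVE_c + Rem·w_c ≤ E'_c` with the Cauchy-majorant Taylor remainder `Rem = m'(b m' h)^{p+1}/(1 − b m' h)`
  of S1 taken FROM THE NODE POINT (weights `w`, `|node|_c ≤ m' w_c`, guard `b m' h < 1`) — no `NVh`, `RemV`, `Dev`
  clauses (theory-1's emitter mode `lohner2`);
* `prodTube_bound`: THE PRODUCT-FORM TUBE by a first-exit argument — if `|ψ(0)|_c ≤ u_c`, `|Q(y,y)_c| ≤ V_c` on the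
  box `|y| ≤ G` and `u_c + h V_c < G_c`, then `|ψ(t)|_c ≤ G_c` and `|ψ(t) − ψ(0)|_c ≤ t V_c` on `[0,h]` (replaces the
  uniform-radius Picard bound `u b_c R_h²` of glue XIX-g by the box's own coordinate ranges).

HONEST FRAMING: abstract finite-dimensional ODE analysis (Taylor models with remainder, Lohner 1987 / Berz–Makino 1998 /
Zgliczyński 2002, via the tree's S1 `TaylorModel.stub_soundness`); nothing about any particular table, no stub closed,
nothing about the Navier–Stokes equations.
-/

noncomputable section

-- the sub-problem namespace repeats the summit name by design (D-0017)
set_option linter.dupNamespace false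

namespace Summit.NavierStokesRegularity.NavierStokesRegularity.Theorems

open Set Finset Summit.NavierStokesRegularity.NavierStokesRegularity.Theorems.TaylorModelReadout

namespace CertificateGlueOn

variable {n : ℕ} {Q : (Fin n → ℝ) → (Fin n → ℝ) → Fin n → ℝ} {b : ℝ}

/-! ### Derivatives of the jets along a line -/

/-- **The Taylor jets along a line have derivative the variational jets at the moving base point.** [folklore] -/
theorem hasDerivAt_taylorJet_line (hQl : ∀ u, IsLinearMap ℝ (Q u)) (hQr : ∀ v, IsLinearMap ℝ (fun u => Q u v))
    (x v : Fin n → ℝ) (k : ℕ) (θ : ℝ) :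
    HasDerivAt (fun θ : ℝ => taylorJet Q (x + θ • v) k) (varJet Q (x + θ • v) v k) θ := by
  induction k using Nat.strong_induction_on generalizing θ with
  | _ k ih =>
  cases k with
  | zero =>
    simp only [taylorJet_zero, varJet_zero]
    have h := ((hasDerivAt_id θ).smul_const v).const_add x
    simpa using h
  | succ k =>
    -- the field as a continuous bilinear map (finite dimension)
    let B : (Fin n → ℝ) →L[ℝ] (Fin n → ℝ) →L[ℝ] (Fin n → ℝ) :=
      LinearMap.toContinuousLinearMap
        { toFun := fun u => LinearMap.toContinuousLinearMap ((hQl u).mk' (Q u))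
          map_add' := fun u u' => by
            ext w c
            simp [(hQr w).map_add u u']
          map_smul' := fun r u => by
            ext w c
            simp [(hQr w).map_smul r u] }
    have hBapp : ∀ u w, B u w = Q u w := fun u w => by simp [B]
    have hk : ((k : ℝ) + 1) ≠ 0 := by positivity
    have hT : (fun θ : ℝ => taylorJet Q (x + θ • v) (k + 1)) = fun θ =>
        ((k : ℝ) + 1)⁻¹ • ∑ i ∈ Finset.range (k + 1),
          Q (taylorJet Q (x + θ • v) i) (taylorJet Q (x + θ • v) (k - i)) := by
      funext θ
      rw [← taylorJet_succ Q (x + θ • v) k, inv_smul_smul₀ hk]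
    rw [hT]
    have hsum : HasDerivAt (fun θ : ℝ => ∑ i ∈ Finset.range (k + 1),
        Q (taylorJet Q (x + θ • v) i) (taylorJet Q (x + θ • v) (k - i)))
        (∑ i ∈ Finset.range (k + 1), (Q (taylorJet Q (x + θ • v) i) (varJet Q (x + θ • v) v (k - i)) +
          Q (varJet Q (x + θ • v) v i) (taylorJet Q (x + θ • v) (k - i)))) θ := by
      refine HasDerivAt.fun_sum fun i hi => ?_
      have hi' : i < k + 1 := Finset.mem_range.mp hi
      have h1 := ih i (by omega) θ
      have h2 := ih (k - i) (by omega) θ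
      have := B.hasDerivAt_of_bilinear (u := fun θ => taylorJet Q (x + θ • v) i)
        (v := fun θ => taylorJet Q (x + θ • v) (k - i)) (fun _ => h1) (fun _ => h2)
      simpa [hBapp] using this
    refine (hsum.const_smul ((k : ℝ) + 1)⁻¹).congr_deriv ?_
    rw [← inv_smul_smul₀ hk (varJet Q (x + θ • v) v (k + 1)), varJet_succ Q (x + θ • v) v k,
      Finset.sum_add_distrib, Finset.sum_add_distrib]
    congr 2
    rw [← Finset.sum_range_reflect (fun i => Q (varJet Q (x + θ • v) v (k - i)) (taylorJet Q (x + θ • v) i))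
      (k + 1)]
    refine Finset.sum_congr rfl fun i hi => ?_
    have hi' : i < k + 1 := Finset.mem_range.mp hi
    have e2 : k + 1 - 1 - i = k - i := by omega
    have e3 : k - (k - i) = i := by omega
    simp only [e2, e3]

/-- **The Taylor polynomial along a line has derivative the variational polynomial at the moving base point.**
[folklore] -/
theorem hasDerivAt_TPoly_line (hQl : ∀ u, IsLinearMap ℝ (Q u)) (hQr : ∀ v, IsLinearMap ℝ (fun u => Q u v))
    (p : ℕ) (x v : Fin n → ℝ) (u : ℝ) (c : Fin n) (θ : ℝ) :
    HasDerivAt (fun θ : ℝ => TPoly Q p (x + θ • v) u c) (VPoly Q p (x + θ • v) v u c) θ := by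
  unfold TPoly VPoly
  refine HasDerivAt.fun_sum fun k _ => ?_
  have h := hasDerivAt_pi.1 (hasDerivAt_taylorJet_line hQl hQr x v k θ) c
  exact h.mul_const _

/-- **THE MEAN-VALUE FORM** of the Taylor polynomial of the flow map: `TP_u(x+v)_c − TP_u(x)_c = VPoly(x + θ v) v u _c`
for some `θ ∈ [0,1]` (depending on the component `c`). [folklore] -/
theorem exists_TPoly_sub_eq_VPoly (hQl : ∀ u, IsLinearMap ℝ (Q u)) (hQr : ∀ v, IsLinearMap ℝ (fun u => Q u v))
    (p : ℕ) (x v : Fin n → ℝ) (u : ℝ) (c : Fin n) :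
    ∃ θ ∈ Icc (0 : ℝ) 1, TPoly Q p (x + v) u c - TPoly Q p x u c = VPoly Q p (x + θ • v) v u c := by
  have hd := fun θ => hasDerivAt_TPoly_line hQl hQr p x v u c θ
  obtain ⟨θ, hθ, heq⟩ := exists_hasDerivAt_eq_slope (fun θ : ℝ => TPoly Q p (x + θ • v) u c)
    (fun θ => VPoly Q p (x + θ • v) v u c) zero_lt_one (fun θ _ => (hd θ).continuousAt.continuousWithinAt)
    (fun θ _ => hd θ)
  refine ⟨θ, Ioo_subset_Icc_self hθ, ?_⟩
  rw [heq]
  simp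

/-! ### The product-form tube (first exit) -/

/-- **THE PRODUCT-FORM TUBE**: for a solution of `ψ' = Q(ψ,ψ)` on `[0,h]` with `|ψ(0)|_c ≤ u_c`, if `|Q(y,y)_c| ≤ V_c` on
the box `|y| ≤ G` (componentwise) and `u_c + h·V_c < G_c` for every `c`, then on `[0,h]` the solution stays in the box
and `|ψ(t) − ψ(0)|_c ≤ t·V_c`. First-exit argument (the bad set is closed, its infimum is bad, but up to it the
derivative bound keeps the solution strictly inside). [folklore] -/
theorem prodTube_bound {V G u₀ : Fin n → ℝ} {h : ℝ} (hh : 0 ≤ h)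
    (hV : ∀ y : Fin n → ℝ, (∀ d, |y d| ≤ G d) → ∀ c, |Q y y c| ≤ V c) (hV0 : ∀ c, 0 ≤ V c)
    {ψ : ℝ → Fin n → ℝ} (hψd : ∀ s ∈ Icc 0 h, HasDerivWithinAt ψ (Q (ψ s) (ψ s)) (Icc 0 h) s)
    (hu : ∀ c, |ψ 0 c| ≤ u₀ c) (hG : ∀ c, u₀ c + h * V c < G c) :
    ∀ t ∈ Icc 0 h, ∀ c, |ψ t c| ≤ G c ∧ |ψ t c - ψ 0 c| ≤ t * V c := by
  have hcont : ContinuousOn ψ (Icc 0 h) := fun s hs => (hψd s hs).continuousWithinAt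
  -- displacement bound on an initial segment on which the box bound holds
  have hdisp : ∀ τ ∈ Icc 0 h, (∀ s ∈ Icc 0 τ, ∀ d, |ψ s d| ≤ G d) →
      ∀ t ∈ Icc 0 τ, ∀ c, |ψ t c - ψ 0 c| ≤ t * V c := by
    intro τ hτ hbox t ht c
    have hder : ∀ s ∈ Icc (0 : ℝ) τ, HasDerivWithinAt (fun s => ψ s c) (Q (ψ s) (ψ s) c) (Icc 0 τ) s :=
      fun s hs => ((hasDerivWithinAt_pi.1 (hψd s ⟨hs.1, hs.2.trans hτ.2⟩)) c).mono (Icc_subset_Icc_right hτ.2)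
    have hbound : ∀ s ∈ Icc (0 : ℝ) τ, ‖Q (ψ s) (ψ s) c‖ ≤ V c := fun s hs => by
      rw [Real.norm_eq_abs]; exact hV (ψ s) (hbox s hs) c
    have hmvt := Convex.norm_image_sub_le_of_norm_hasDerivWithin_le hder hbound (convex_Icc 0 τ)
      (show (0 : ℝ) ∈ Icc 0 τ from ⟨le_rfl, ht.1.trans ht.2⟩) ht
    rw [Real.norm_eq_abs, Real.norm_eq_abs, sub_zero, abs_of_nonneg ht.1] at hmvt
    linarith [hmvt]
  -- the start is strictly inside
  have hstart : ∀ c, |ψ 0 c| < G c := fun c => by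
    have := hu c; have := hG c; have := mul_nonneg hh (hV0 c); linarith
  -- the box bound holds on the whole step (first exit)
  have hbox : ∀ s ∈ Icc 0 h, ∀ d, |ψ s d| ≤ G d := by
    by_contra hcon
    push Not at hcon
    obtain ⟨s₀, hs₀, d₀, hd₀⟩ := hcon
    set F : Set (Fin n → ℝ) := ⋃ d : Fin n, {y | G d ≤ |y d|} with hF
    have hFc : IsClosed F :=
      isClosed_iUnion_of_finite fun d => isClosed_le continuous_const (continuous_abs.comp (continuous_apply d))
    set B : Set ℝ := Icc 0 h ∩ ψ ⁻¹' F with hB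
    have hBc : IsClosed B := hcont.preimage_isClosed_of_isClosed isClosed_Icc hFc
    have hBne : B.Nonempty := ⟨s₀, hs₀, by simp only [hF, Set.mem_preimage, Set.mem_iUnion, Set.mem_setOf_eq]; exact ⟨d₀, hd₀.le⟩⟩
    have hBbdd : BddBelow B := ⟨0, fun s hs => hs.1.1⟩
    set u₁ := sInf B with hu₁
    have hu₁B : u₁ ∈ B := hBc.csInf_mem hBne hBbdd
    have hu₁h : u₁ ∈ Icc 0 h := hu₁B.1
    -- strictly before `u₁` the solution is inside the box
    have hbefore : ∀ s ∈ Icc 0 h, s < u₁ → ∀ d, |ψ s d| ≤ G d := by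
      intro s hs hsu d
      by_contra hgt
      push Not at hgt
      have hsB : s ∈ B := ⟨hs, by simp only [hF, Set.mem_preimage, Set.mem_iUnion, Set.mem_setOf_eq]; exact ⟨d, hgt.le⟩⟩
      exact absurd (csInf_le hBbdd hsB) (not_le.mpr hsu)
    -- hence (closedness) on the closed segment `[0, u₁]`
    have hupto : ∀ s ∈ Icc 0 u₁, ∀ d, |ψ s d| ≤ G d := by
      intro s hs d
      rcases eq_or_lt_of_le hs.2 with hseq | hslt
      · rcases eq_or_lt_of_le hu₁h.1 with hu0 | hu0
        · rw [hseq, ← hu0]; exact (hstart d).le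
        · -- limit from the left
          set A : Set ℝ := Icc 0 h ∩ (fun s => |ψ s d|) ⁻¹' Iic (G d) with hA
          have hAc : IsClosed A :=
            ((continuous_abs.comp (continuous_apply d)).comp_continuousOn hcont).preimage_isClosed_of_isClosed
              isClosed_Icc isClosed_Iic
          have hsub : Ico 0 u₁ ⊆ A := fun s' hs' =>
            ⟨⟨hs'.1, hs'.2.le.trans hu₁h.2⟩, hbefore s' ⟨hs'.1, hs'.2.le.trans hu₁h.2⟩ hs'.2 d⟩
          have hcl : closure (Ico 0 u₁) ⊆ A := hAc.closure_subset_iff.2 hsub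
          rw [closure_Ico hu0.ne] at hcl
          have := hcl ⟨hs.1, hs.2⟩
          exact this.2
      · exact hbefore s ⟨hs.1, hslt.le.trans hu₁h.2⟩ hslt d
    -- so at `u₁` it is strictly inside: contradiction with `u₁ ∈ B`
    have hin : ∀ c, |ψ u₁ c| < G c := fun c => by
      have h1 := hdisp u₁ hu₁h hupto u₁ ⟨hu₁h.1, le_rfl⟩ c
      have h2 : u₁ * V c ≤ h * V c := mul_le_mul_of_nonneg_right hu₁h.2 (hV0 c)
      have h3 : |ψ u₁ c| ≤ |ψ 0 c| + |ψ u₁ c - ψ 0 c| := by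
        have := abs_add_le (ψ 0 c) (ψ u₁ c - ψ 0 c); rwa [add_sub_cancel] at this
      linarith [hu c, hG c]
    have hbad := hu₁B.2
    simp only [hF, Set.mem_preimage, Set.mem_iUnion, Set.mem_setOf_eq] at hbad
    obtain ⟨d, hd⟩ := hbad
    exact absurd hd (not_le.mpr (hin d))
  exact fun t ht c => ⟨hbox t ht c, hdisp h ⟨hh, le_rfl⟩ hbox t ht c⟩

/-! ### The mean-value Lohner landing with a remainder vector -/

/-- **THE MEAN-VALUE LOHNER LANDING WITH A REMAINDER VECTOR** (see the module docstring for the clauses; `w` = the S1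
weights used for the Taylor remainder from the node point, `T` = the coordinate transport, `Cn` = the next frame).
[cite: Zgliczynski2002C1Lohner, §3–4 (Lohner-type parallelepiped frames: mean-value form of the C¹ enclosure)] -/
theorem lohner_land_mv (hQl : ∀ u, IsLinearMap ℝ (Q u)) (hQr : ∀ v, IsLinearMap ℝ (fun u => Q u v))
    {w : Fin n → ℝ} (hw : ∀ c, 0 < w c) (hb : 0 ≤ b)
    (hB : ∀ (u v : Fin n → ℝ) (Nu Nv : ℝ), 0 ≤ Nu → 0 ≤ Nv → (∀ c, |u c| ≤ Nu * w c) →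
      (∀ c, |v c| ≤ Nv * w c) → ∀ c, |Q u v c| ≤ b * Nu * Nv * w c)
    {p : ℕ} {h m' : ℝ} {x x' : Fin n → ℝ} {C Cn T : Matrix (Fin n) (Fin n) ℝ}
    {r r' ρ E E₁ dP κ NVE : Fin n → ℝ} (hh : 0 ≤ h) (hm' : 0 ≤ m')
    (hnode : ∀ ξ e : Fin n → ℝ, (∀ c, |ξ c| ≤ r c) → (∀ c, |e c| ≤ E c) →
      ∀ c, |(x + (C.mulVec ξ + e)) c| ≤ m' * w c)
    (hguard : b * m' * h < 1)
    (hC : ∀ ξ : Fin n → ℝ, (∀ c, |ξ c| ≤ r c) → ∀ c, |C.mulVec ξ c| ≤ ρ c)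
    (hdP : ∀ c, |TPoly Q p x h c - x' c| ≤ dP c)
    (hκ : ∀ z : Fin n → ℝ, (∀ d, |z d - x d| ≤ ρ d + E d) → ∀ ξ : Fin n → ℝ, (∀ c, |ξ c| ≤ r c) →
      ∀ c, |(VPoly Q p z (C.mulVec ξ) h - Cn.mulVec (T.mulVec ξ)) c| ≤ κ c)
    (hNVE : ∀ z : Fin n → ℝ, (∀ d, |z d - x d| ≤ ρ d + E d) → ∀ e : Fin n → ℝ, (∀ c, |e c| ≤ E c) →
      ∀ c, |VPoly Q p z e h c| ≤ NVE c)
    (hframe : ∀ ξ : Fin n → ℝ, (∀ c, |ξ c| ≤ r c) → ∀ c, |T.mulVec ξ c| ≤ r' c)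
    (hE₁ : ∀ c, dP c + κ c + NVE c + m' * (b * m' * h) ^ (p + 1) / (1 - b * m' * h) * w c ≤ E₁ c) :
    ∀ (ξ e : Fin n → ℝ), (∀ c, |ξ c| ≤ r c) → (∀ c, |e c| ≤ E c) →
      ∀ ψ : ℝ → Fin n → ℝ, ψ 0 = x + (C.mulVec ξ + e) →
        (∀ s ∈ Icc 0 h, HasDerivWithinAt ψ (Q (ψ s) (ψ s)) (Icc 0 h) s) →
          ∃ ξ' e' : Fin n → ℝ, (∀ c, |ξ' c| ≤ r' c) ∧ (∀ c, |e' c| ≤ E₁ c) ∧ ψ h = x' + (Cn.mulVec ξ' + e') := by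
  intro ξ e hξ he ψ hψ0 hψd
  set v := C.mulVec ξ + e with hvdef
  set y := x + v with hydef
  obtain ⟨Φ, hΦ0, huniq, hΦ⟩ :=
    Summit.NavierStokesRegularity.NavierStokesRegularity.Theorems.TaylorModel.stub_soundness n Q w b
      (taylorJet Q) (varJet Q) hw hb hQl hQr hB (taylorJet_zero Q) (taylorJet_succ_apply Q)
      (varJet_zero Q) (varJet_succ_apply Q)
  -- the solution is the selector from the node point `y`
  have hψΦ : ψ h = Φ y h := huniq y h ψ hh hψ0 hψd h ⟨hh, le_rfl⟩
  -- S1 at the node point: the Taylor remainder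
  have hyw : ∀ c, |y c| ≤ m' * w c := hnode ξ e hξ he
  obtain ⟨-, -, -, hrem, -⟩ := hΦ y m' h hm' hyw hh hguard
  have hR : ∀ c, |Φ y h c - TPoly Q p y h c| ≤ m' * (b * m' * h) ^ (p + 1) / (1 - b * m' * h) * w c := fun c => by
    simpa [TPoly] using hrem h ⟨hh, le_rfl⟩ p c
  -- the hull box contains the segment from the centre to the node point
  have hv : ∀ d, |v d| ≤ ρ d + E d := fun d => by
    simp only [hvdef, Pi.add_apply]
    exact (abs_add_le _ _).trans (add_le_add (hC ξ hξ d) (he d))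
  have hz : ∀ θ ∈ Icc (0 : ℝ) 1, ∀ d, |(x + θ • v) d - x d| ≤ ρ d + E d := by
    intro θ hθ d
    simp only [Pi.add_apply, Pi.smul_apply, smul_eq_mul, add_sub_cancel_left, abs_mul, abs_of_nonneg hθ.1]
    exact (mul_le_of_le_one_left (abs_nonneg _) hθ.2).trans (hv d)
  -- the new coordinates and the remainder vector
  set ξ' := T.mulVec ξ with hξ'
  refine ⟨ξ', ψ h - x' - Cn.mulVec ξ', hframe ξ hξ, fun c => ?_, by abel⟩
  -- mean value per component
  obtain ⟨θ, hθ, hmv⟩ := exists_TPoly_sub_eq_VPoly hQl hQr p x v h c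
  set z := x + θ • v with hzdef
  have hsplit : VPoly Q p z v h c = VPoly Q p z (C.mulVec ξ) h c + VPoly Q p z e h c := by
    have := congrFun (VPoly_add hQl hQr p z (C.mulVec ξ) e h) c
    simpa [hvdef] using this
  have e1 : (ψ h - x' - Cn.mulVec ξ') c =
      (Φ y h c - TPoly Q p y h c) + (TPoly Q p x h c - x' c) +
        (VPoly Q p z (C.mulVec ξ) h - Cn.mulVec (T.mulVec ξ)) c + VPoly Q p z e h c := by
    rw [hψΦ]
    have hy' : TPoly Q p y h c = TPoly Q p x h c + VPoly Q p z v h c := by rw [hydef]; linarith [hmv]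
    simp only [Pi.sub_apply, hy', hsplit, hξ']
    ring
  rw [e1]
  have h1 := hR c
  have h2 := hdP c
  have h3 := hκ z (hz θ hθ) ξ hξ c
  have h4 := hNVE z (hz θ hθ) e he c
  calc |(Φ y h c - TPoly Q p y h c) + (TPoly Q p x h c - x' c) +
        (VPoly Q p z (C.mulVec ξ) h - Cn.mulVec (T.mulVec ξ)) c + VPoly Q p z e h c|
      ≤ |Φ y h c - TPoly Q p y h c| + |TPoly Q p x h c - x' c| +
        |(VPoly Q p z (C.mulVec ξ) h - Cn.mulVec (T.mulVec ξ)) c| + |VPoly Q p z e h c| := by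
          refine (abs_add_le _ _).trans (add_le_add ((abs_add_le _ _).trans (add_le_add (abs_add_le _ _) le_rfl))
            le_rfl)
    _ ≤ E₁ c := by linarith [hE₁ c]

end CertificateGlueOn

end Summit.NavierStokesRegularity.NavierStokesRegularity.Theorems

end
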